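import Summits.BirchSwinnertonDyer.BirchSwinnertonDyer.Theorems.EisensteinPrimesBSDpOnCellCOfCitedFactsV20
import Summits.BirchSwinnertonDyer.BirchSwinnertonDyer.Theorems.EisensteinPrimesBSDpOnCellCOfNamedFactsV23
import Summits.BirchSwinnertonDyer.BirchSwinnertonDyer.Theorems.EisensteinPrimesBSDpOnCellCTelescopeK2WeightTwoPseudoNullP22
import Summits.BirchSwinnertonDyer.BirchSwinnertonDyer.Theorems.EisensteinPrimesBSDpOnCellCTelescopeK2WeightTwoControlOfPubOfPseudoNullP22
import Summits.BirchSwinnertonDyer.BirchSwinnertonDyer.Theorems.EisensteinPrimesBSDpOnCellCTelescopeK2ModuleDivOfLeavesFPGM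
import HarnessLib

/-!
# [telescope v21 — width seat bsd-line-x2-p2 g27, 2026-08-30] CRUX 4 `BSDpOnCellC` FROM 22 (NOT 23) REFEREED FACTS, KELLER–YIN ×3, T-An-2ʳ AND CRUX 3 — CGLS 2022 Prop. 1.2.5
# (`prop125_characterGrSelmerDual_torsion_muZero_dim`, #16 of `stub_publishedFacts`) IS NOT A HYPOTHESIS — CONDITIONAL CLOSURE, SORRY-FREE
# (sibling of x2-p2 g26's p783713 `…OfCitedFactsR3.bsdpOnCellC_of_citedFactsR_pre3` with ONE hypothesis conjunct FEWER — the prop125 lane; independent of LEAD g9's parallel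
# K-lane / CAS-lane closures R4–R6 (Kolyvagin Thm. A, Castella 2018 Thms. 2.10–2.11), with which it composes; `--supports`, helper; CONDITIONAL — closes nothing)
# Crux 4 `BSDpOnCellC` (stmt-BirchSwinnertonDyer-19034), line «telescope» v21 (skeleton 9eb63b9f… UNCHANGED).

WHAT: `bsdpOnCellC_of_citedFactsR7 (hPub) (hPre) (hRat) (hMazur) : …Theses.EisensteinPrimes.BSDpOnCellC` with **`hPub` = v21's `stub_publishedFacts` text with EXACTLY
the conjunct `prop125_characterGrSelmerDual_torsion_muZero_dim` REMOVED (22 refereed named facts; every other token as in v21 / R3)**, `hPre` = v21's `stub_preprintFacts3`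
text (Keller–Yin ×3), `hRat` = T-An-2ʳ, `hMazur` = crux 3 — all VERBATIM. PROOF = R3's composition term with three substitutions: the head
`…OfNamedFactsV22.bsdpOnCellC_of_namedFactsV22P` ↦ this seat's `…OfNamedFactsV23.bsdpOnCellC_of_namedFactsV23P` (prop125-free head: Keller–Yin Lemma 5.1.1 and the
non-split imprimitive count re-derived from BCGKPST Thm. 3.3.1 / de Shalit II.6.4 / Hida Thm. I / CGLS Thm. 2.1.2 / Cor. 1.2.6 ×2 / Milne I 4.10 (a) / Greenberg
2006–2016 by name through the character main-conjecture engines at the Teichmüller pair, the strict GV Cor. (2.3) twin, the strict `Q[p]` finiteness, the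
rank-one almost-divisibility road and the pointwise corank clause — files p787997 p788955 p789816 p790367 p791489 p792309 p792380 p792504 p793288 + #10 #11 #14 #15),
and the two K2 weight-two leaves ↦ their 22-name re-typings (`TelescopeK2WeightTwoControlOfPubOfPseudoNullP22.weightTwoControlOfPub22_of_pseudoNull`,
`TelescopeK2WeightTwoPseudoNullP22.weightTwoPseudoNullOfPub22`), which receive `hPub` whole.
MEANING (the C2 programme's target, memo rev 0.3 = evidence #59): the by-name register of crux 4 CAN be 22 refereed + KY24 ×3 + T-An-2ʳ + crux 3 = 26 + crux 3
(v21 books 27 + crux 3). A v22 reshape (`stub_publishedFacts` 23 → 22 conjuncts under a fresh name) is the LEAD's registry act under a NEW director word after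
host (S2)-style certification of THESE landed bytes (host (C2)/(C4)); this file is the kernel evidence for it and asserts nothing about the registry.
HONEST FRAMING: CONDITIONAL result (the gate records it as such); it discharges none of its hypotheses; closes no registered stub, no crux, no summit statement;
BSD is proved for no curve by this file. THEOREMS ONLY: no definition, no named fact, no instance, no `sorry`.
References (shape only): [cite: KellerYin2024, Thm. 3.0.8, Thm. 2.2.2 (arXiv:2402.12781v2)] [cite: GreenbergVatsal2000, Thm. (1.3)] [cite: Wiles1988, §2.2] [cite: Hida1986, Cor. 1.3, Cor. 1.4]
[cite: CastellaGrossiLeeSkinner2022, Prop. 1.2.5 (the removed hypothesis), Thm. 1.2.2, Cor. 1.2.6, Thm. 2.1.2] [cite: BleherEtAl2020, §3.3 Thm. 3.3.1] [cite: MilneADT2006, I Thm. 4.10 (a)]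
-/

set_option autoImplicit false
set_option linter.dupNamespace false

noncomputable section

open scoped Classical MatrixGroups ModularForm

open CongruenceSubgroup WeierstrassCurve NumberField IsDedekindDomain Field PowerSeries
  Literature.NumberTheory.EllipticCurves Literature.NumberTheory.EllipticCurves.GreenbergSelmer
  Literature.NumberTheory.EllipticCurves.ModularForms Literature.NumberTheory.QuadraticFields
  Literature.NumberTheory.EllipticCurves.Rank1Residual
  Literature.NumberTheory.EllipticCurves.Rank1Residual.Typed
  Literature.NumberTheory.EllipticCurves.KrizLi2019
  Literature.NumberTheory.EllipticCurves.GreenbergVatsal2000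
  Literature.NumberTheory.EllipticCurves.Wuthrich2014
  Literature.NumberTheory.EllipticCurves.SteinWuthrich2013
  Literature.NumberTheory.EllipticCurves.Castella2018Exceptional
  Literature.NumberTheory.GaloisRepresentations Literature.NumberTheory.GaloisCohomology
  Literature.NumberTheory.Automorphic
  Summit.BirchSwinnertonDyer.Rank1Residual.X11b.AcSelmer
  Summit.BirchSwinnertonDyer.Rank1Residual.X11b.Halves
  Summit.BirchSwinnertonDyer.Rank1Residual.X11b
  Summit.BirchSwinnertonDyer.Rank1Residual Summit.BirchSwinnertonDyer.Rank1Residual.X1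
  Summit.BirchSwinnertonDyer.Rank1Residual.X2
open Literature.NumberTheory.EllipticCurves.KellerYin2024 (curveLocalLambda)


open Literature.NumberTheory.EllipticCurves.BigGaloisRep

namespace Summit.BirchSwinnertonDyer.BirchSwinnertonDyer.Theorems.EisensteinPrimesBSDpOnCellCOfCitedFactsR7

open Literature.NumberTheory.EllipticCurves.CastellaGrossiLeeSkinner2022 Literature.NumberTheory.EllipticCurves.Castella2018
  Literature.NumberTheory.IwasawaTheory Literature.NumberTheory.IwasawaTheory.Greenberg2016
  Literature.NumberTheory.IwasawaTheory.Greenberg2006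
  Summit.BirchSwinnertonDyer.Rank1Residual.X1.KellerYinMuLambdaSplit
open Literature.NumberTheory.EllipticCurves.KellerYin2024
open Summit.BirchSwinnertonDyer.BirchSwinnertonDyer.Theorems

/-- **Crux 4 `BSDpOnCellC` from 22 refereed facts (v21's `stub_publishedFacts` minus CGLS Prop. 1.2.5), Keller–Yin ×3 (v21's `stub_preprintFacts3`), T-An-2ʳ and crux 3
(telescope v21 chain with the FPGM glue, the prop125-free head V23P and the 22-name K2 leaves; conditional closure).** CONDITIONAL: nothing here discharges the hypotheses.
[cite: KellerYin2024, Thm. 3.0.8 (shape only)] [cite: GreenbergVatsal2000, Thm. (1.3) (shape only)] [cite: CastellaGrossiLeeSkinner2022, Prop. 1.2.5 (removed), Thm. 2.1.2] -/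
theorem bsdpOnCellC_of_citedFactsR7
    (hPub :
    ((((lambdaMu_multiplicative_of_gvPar ∧ thm16_charIdeal_dvd_multiplicative_of_reducible ∧
    thm61_splitMultiplicative ∧ thm61_nonsplitMultiplicative ∧
    (∀ (W : WeierstrassCurve ℚ) [W.IsElliptic] [W.IsGloballyMinimal] (p : ℕ) [Fact p.Prime],
      greenberg_stevens (W := W) (p := p)) ∧
    exists_isNewformOf ∧
    hsieh2014_exists_anticyclotomicPAdicLFunction ∧
    (∀ (N : ℕ) [NeZero N] (W : WeierstrassCurve ℚ) (K : Type) [Field K] [NumberField K],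
      gross_zagier N W K) ∧
    (∀ (N : ℕ) [NeZero N] (W : WeierstrassCurve ℚ) (K : Type) [Field K] [NumberField K],
      kolyvagin N W K) ∧
    rank_eq_analyticRank_of_analyticRank_le_one ∧ HoffsteinLuo1997_exists_twist_L_one_ne_zero ∧
    mazur_not_dvd_maninConstant_of_odd ∧ bsdRHS_eq_of_isIsogenous) ∧
    thm210_thm211_bdpDisplay_pNew) ∧
    LiuZhangZhang2018.thm151_thm153_modularCurve_heegnerVector) ∧
    (cor126_residualCharacter_globalLift ∧ cor126_residualCharacter_localSurjective ∧
      thm212_exists_isKatzLFunction ∧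
      Literature.NumberTheory.EllipticCurves.Castella2018.cas20_thm211_memberForms_sigmaFrames_congr)) ∧
      Literature.NumberTheory.EllipticCurves.BCGKPST2020.thm331_rubin_exists_katzMeasure₂_pseudoIso_span_eq ∧
      Literature.NumberTheory.EllipticCurves.DeShalit1987.thmII64_katzMeasure₂_functionalEquation ∧
      Literature.NumberTheory.EllipticCurves.Hida2010MuInvariant.thmI_mu_katzBranch_reflect_eq_zero)
    (hPre :
    Literature.NumberTheory.EllipticCurves.KellerYin2024.thm308_imc2_hidaMember_dvd_OPEN ∧
      Literature.NumberTheory.EllipticCurves.KellerYin2024.thm222_anacong_hidaMember_sigma_mu_OPEN ∧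
      Literature.NumberTheory.EllipticCurves.KellerYin2024.thm222_anacong_hidaMember_sigma_lambda_OPEN)
    (hRat : Literature.NumberTheory.EllipticCurves.hida1986_castella2020_exists_rationalMembers_on_pNewBranchChart)
    (hMazur :
    Summit.BirchSwinnertonDyer.BirchSwinnertonDyer.Theses.EisensteinPrimes.MazurMCOnCellB) :
    Summit.BirchSwinnertonDyer.BirchSwinnertonDyer.Theses.EisensteinPrimes.BSDpOnCellC :=
  Summit.BirchSwinnertonDyer.BirchSwinnertonDyer.Theorems.EisensteinPrimesBSDpOnCellCOfNamedFactsV23.bsdpOnCellC_of_namedFactsV23P hPub hPre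
    (Summit.BirchSwinnertonDyer.BirchSwinnertonDyer.Theorems.TelescopeCarrierOfAnDistRatOfAlgFPG.carrier_of_anDistRat_of_algFP
      (Summit.BirchSwinnertonDyer.BirchSwinnertonDyer.Theorems.TelescopeCarrierAnDistRatGalOfGaloisLattice.carrierAnDistRatGal_of_galoisLattice
        (Summit.BirchSwinnertonDyer.BirchSwinnertonDyer.Theorems.TelescopeBranchGaloisLatticeOfUntwistedFact.galoisLattice_of_untwistedGaloisLattice
          (Summit.BirchSwinnertonDyer.BirchSwinnertonDyer.Theorems.TelescopeBranchUntwistedOfFrobenius.untwistedGaloisLattice_of_frobeniusGaloisLattice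
            (Summit.BirchSwinnertonDyer.BirchSwinnertonDyer.Theorems.TelescopeBranchFrobeniusLatticeOfChart.frobeniusGaloisLattice_of_rationalMembers
              hRat))))
      (Summit.BirchSwinnertonDyer.BirchSwinnertonDyer.Theorems.TelescopeCarrierAlgOfWitnessFPG.carrierAlg_of_witness
        (Summit.BirchSwinnertonDyer.BirchSwinnertonDyer.Theorems.TelescopeCarrierAlgWOfDivIntFPG.carrierAlgW_of_divInt
          (Summit.BirchSwinnertonDyer.BirchSwinnertonDyer.Theorems.TelescopeK2DivIntOfModuleDivFPG.carrierDivInt_of_branchFibreDiv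
            (Summit.BirchSwinnertonDyer.BirchSwinnertonDyer.Theorems.TelescopeK2ModuleDivOfLeavesFPGM.branchFibreDiv_of_leaves_of_modCofinite
              Summit.BirchSwinnertonDyer.BirchSwinnertonDyer.Theorems.TelescopeBranchLatticeOfPkgG.branchLattice_of_pkgG
              (Summit.BirchSwinnertonDyer.BirchSwinnertonDyer.Theorems.TelescopeK2WeightTwoControlOfPubOfPseudoNullP22.weightTwoControlOfPub22_of_pseudoNull
                Summit.BirchSwinnertonDyer.BirchSwinnertonDyer.Theorems.TelescopeK2WeightTwoPseudoNullP22.weightTwoPseudoNullOfPub22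
                hPub)
              Summit.BirchSwinnertonDyer.BirchSwinnertonDyer.Theorems.TelescopeMemberControlModCofinite.stub_memberControlModCofinite)))
        Summit.BirchSwinnertonDyer.BirchSwinnertonDyer.Theorems.TelescopeHerbrandTranslate.stub_herbrandTranslate))
    hMazur

end Summit.BirchSwinnertonDyer.BirchSwinnertonDyer.Theorems.EisensteinPrimesBSDpOnCellCOfCitedFactsR7

end
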